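import Summits.Ventures.Crystal3D.Theorems.StickyWulffConstantTextureLiminfTexShadowLevelReachBornArea
import Summits.Ventures.Crystal3D.Theorems.StickyWulffConstantGenericWallFloorGrainCredits
import Summits.Ventures.Crystal3D.Theorems.StickyWulffConstantGenericWallFloorSlotCovering
import HarnessLib

/-!
# The SOLID VOLUME of a band: a complete horizontal band sample of a moved close-packed lattice has `≥ √2·π·(R−1)·(ρ−2R)² − 20·π·R·(ρ−2R)` balls
# (lane T, crux `TextureLiminfV5`, stmt-Ventures-23912, registered stub `stub_terraceCensus`; (β) born SUPPLY law, «the lamella's solid volume» owed after p753964)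

HONEST FRAMING. Venture `Summits/Ventures/Crystal3D` (cell `crystal3d-full`), route `route-Ventures-StickyWulffConstant`, helper `--supports` the
law-v5 crux `TextureLiminfV5` (stmt-Ventures-23912), lane T, mechanism (β).  Lattice-line counting only; standard axioms; census-free, certificate-free;
nothing about energies; F-C1 not moved.

THE POINT.  19480-p1's born SUPPLY census (`inner_trackable_le_census`, …LevelReachBornSupplyCensus p753964) bounds every finite set `R` of INNER TRACKABLE
balls of a lamella by `K·(ends + cuts + rims)`; what it leaves to the assembly is «the lattice-geometric count of those balls (the lamella's solid volume)».
This file is that count for the basic solid: the COMPLETE band sample `P = (A·Λ₀ + t) ∩ {a ≤ p₂ ≤ a + R, p₀² + p₁² ≤ ρ²}` (`R ≥ 1`, `ρ ≥ 2R + 1`):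
* **`card_band_sample_ge`** — `√2·π·(R − 1)·(ρ − 2R)² − 20·π·R·(ρ − 2R) ≤ #P` (number density `√2`; one unit of height and a rim of width `2R` are given away);
* **`full_of_inner_band`** — if the band sample lies in `X`, every lattice point one unit inside it (heights `[a+1, a+R−1]`, lateral radius `≤ ρ − 1`) is FULL in
  `A` (`IsFull X A p`) and has every slot-predecessor `p − A w ∈ X` — i.e. is TRACKABLE in the sense of `inner_trackable_le_census` for every class `A w`
  (apply `card_band_sample_ge` to the inner band to count them).
PROOF.  By the `45°` slot covering (`exists_slot_cover`, …SlotCovering) some slot `s` has `c = A s` with `c₂ ≥ √2/2`.  The bottom band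
`P₁ = sample {a ≤ p₂ ≤ a+1, lateral ≤ ρ − 2R}` has `≥ √2·c₂·π·(ρ−2R)² − 10√2·π·(ρ−2R)` run bottoms of class `s` (`bottoms_ge_lineCount`, …LevelReachBornArea);
from each bottom `p` the points `p + j·c`, `0 ≤ j ≤ ⌊(R−1)/c₂⌋`, lie in `P` (heights climb by `c₂ ≤ 1` per step, the lateral radius drifts by `≤ 1` per step:
`sqrt_lateral_add_le`), and `(p, j) ↦ p + j·c` is injective on bottoms × steps (two bottoms of the unit band on one line are `< 2` steps apart, and one step apart
would make the upper one's predecessor a sample point).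
WHAT THIS IS NOT: the trackability of those balls (completeness of the lamella's material around them — the assembly's pinning input), any census; F-C1 not moved.
-/

noncomputable section

namespace Summit.Ventures.Crystal3D.Theorems

open Summit.Ventures.Crystal3D Finset
open Literature.MathematicalPhysics.StatisticalMechanics (fccStacking)
open Summit.Ventures.Crystal3D.Cruxes.TextureLiminf.TexShadow (E3)
open scoped InnerProductSpace

set_option maxHeartbeats 400000 in
open scoped Classical in
/-- **The solid volume of a complete band sample.**  See the module docstring. -/
theorem card_band_sample_ge (A : E3 ≃ₗᵢ[ℝ] E3) (t : E3) (a R ρ : ℝ) (hR : 1 ≤ R) (hρ : 2 * R + 1 ≤ ρ) (P : Finset E3)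
    (hP : ∀ p, p ∈ P ↔ (p ∈ (fun q => A q + t) '' fccStacking 1 (Real.sqrt (2 / 3)) ∧
      a ≤ p 2 ∧ p 2 ≤ a + R ∧ p 0 ^ 2 + p 1 ^ 2 ≤ ρ ^ 2)) :
    Real.sqrt 2 * Real.pi * (R - 1) * (ρ - 2 * R) ^ 2 - 20 * Real.pi * R * (ρ - 2 * R) ≤ (P.card : ℝ) := by
  set e : E3 := EuclideanSpace.single (2 : Fin 3) (1 : ℝ) with he
  have hen : ‖e‖ = 1 := by rw [he, PiLp.norm_single, norm_one]
  -- a steep slot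
  have hvn : ‖A.symm e‖ = 1 := by rw [LinearIsometryEquiv.norm_map, hen]
  obtain ⟨s, hs, hcov⟩ := exists_slot_cover hvn
  set c : E3 := A s with hc
  have hc2 : Real.sqrt 2 / 2 ≤ c 2 := by
    have h1 : ⟪A.symm e, s⟫_ℝ = ⟪e, c⟫_ℝ := by
      rw [hc, ← LinearIsometryEquiv.inner_map_map A (A.symm e) s, LinearIsometryEquiv.apply_symm_apply]
    have h2 : ⟪e, c⟫_ℝ = c 2 := by rw [he, EuclideanSpace.inner_single_left]; simp
    have h3 : ⟪A.symm e, s⟫_ℝ = c 2 := h1.trans h2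
    rw [h3] at hcov; exact hcov
  have hs2 : Real.sqrt 2 ≤ 1.4143 := by
    rw [show (1.4143 : ℝ) = Real.sqrt (1.4143 ^ 2) by rw [Real.sqrt_sq (by norm_num)]]
    exact Real.sqrt_le_sqrt (by norm_num)
  have hs2l : (1.4142 : ℝ) ≤ Real.sqrt 2 := by
    rw [show (1.4142 : ℝ) = Real.sqrt (1.4142 ^ 2) by rw [Real.sqrt_sq (by norm_num)]]
    exact Real.sqrt_le_sqrt (by norm_num)
  have hc2pos : 0 < c 2 := by linarith
  have hcn : ‖c‖ = 1 := by rw [hc, LinearIsometryEquiv.norm_map, norm_eq_one_of_mem_fccSlots hs]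
  have hc21 : c 2 ≤ 1 := by
    have := Literature.Algebra.EuclideanLattices.norm_sq_fin_three c
    rw [hcn, one_pow] at this; nlinarith [sq_nonneg (c 0), sq_nonneg (c 1), sq_nonneg (c 2 - 1)]
  -- the bottom unit band of radius `ρ₁ = ρ − 2R`
  set ρ₁ : ℝ := ρ - 2 * R with hρ₁
  have hρ₁1 : 1 ≤ ρ₁ := by rw [hρ₁]; linarith
  have hρ₁0 : 0 ≤ ρ₁ := by linarith
  set P₁ : Finset E3 := P.filter fun p => p 2 ≤ a + 1 ∧ p 0 ^ 2 + p 1 ^ 2 ≤ ρ₁ ^ 2 with hP₁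
  have hP₁mem : ∀ p, p ∈ P₁ ↔ (p ∈ (fun q => A q + t) '' fccStacking 1 (Real.sqrt (2 / 3)) ∧
      a ≤ p 2 ∧ p 2 ≤ a + 1 ∧ p 0 ^ 2 + p 1 ^ 2 ≤ ρ₁ ^ 2) := by
    intro p
    rw [hP₁, mem_filter, hP]
    constructor
    · rintro ⟨⟨hΛ, h1, -, -⟩, h2, h3⟩; exact ⟨hΛ, h1, h2, h3⟩
    · rintro ⟨hΛ, h1, h2, h3⟩
      refine ⟨⟨hΛ, h1, by linarith, h3.trans ?_⟩, h2, h3⟩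
      nlinarith
  set B₁ : Finset E3 := P₁.filter fun p => p - c ∉ P₁ with hB₁
  have hB₁card := bottoms_ge_lineCount A t a 1 ρ₁ le_rfl hρ₁1 P₁ hP₁mem hs
  rw [← he, ← hc, ← hB₁] at hB₁card
  have habs : |⟪c, e⟫_ℝ| = c 2 := by
    have : ⟪c, e⟫_ℝ = c 2 := by rw [he, EuclideanSpace.inner_single_right]; simp
    rw [this, abs_of_pos hc2pos]
  rw [habs] at hB₁card
  -- the steps
  set J : ℕ := ⌊(R - 1) / c 2⌋₊ with hJ
  have hJle : (J : ℝ) ≤ (R - 1) / c 2 := Nat.floor_le (div_nonneg (by linarith) hc2pos.le)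
  have hJge : (R - 1) / c 2 < (J : ℝ) + 1 := Nat.lt_floor_add_one _
  have hJc : (J : ℝ) * c 2 ≤ R - 1 := by rwa [le_div_iff₀ hc2pos] at hJle
  have h22 : Real.sqrt 2 * Real.sqrt 2 = 2 := Real.mul_self_sqrt (by norm_num)
  have hsc : 1 ≤ Real.sqrt 2 * c 2 := by nlinarith [hc2, h22]
  have hJR : (J : ℝ) ≤ Real.sqrt 2 * (R - 1) := by
    have : (R - 1) / c 2 ≤ Real.sqrt 2 * (R - 1) := by
      rw [div_le_iff₀ hc2pos]
      nlinarith [mul_nonneg (show (0:ℝ) ≤ R - 1 by linarith) (show 0 ≤ Real.sqrt 2 * c 2 - 1 by linarith)]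
    linarith
  -- the map `(p, j) ↦ p + j•c` on `B₁ × range (J+1)` lands in `P` and is injective
  have hlat_iter : ∀ (p : E3) (j : ℕ), Real.sqrt ((p + (j : ℝ) • c) 0 ^ 2 + (p + (j : ℝ) • c) 1 ^ 2) ≤
      Real.sqrt (p 0 ^ 2 + p 1 ^ 2) + j := by
    intro p j
    have h := sqrt_lateral_add_le p ((j : ℝ) • c)
    rw [norm_smul, hcn, mul_one, Real.norm_eq_abs, abs_of_nonneg (Nat.cast_nonneg j)] at h
    exact h
  have hiter : ∀ (q : E3), q ∈ fccStacking 1 (Real.sqrt (2 / 3)) → ∀ n : ℕ, q + (n : ℝ) • s ∈ fccStacking 1 (Real.sqrt (2 / 3)) := by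
    intro q hq n
    induction n with
    | zero => simpa using hq
    | succ n ih =>
      have := add_mem_fcc_of_mem_fccSlots ih hs
      push_cast; rw [add_smul, one_smul, ← add_assoc]; exact this
  have hmapsP : ∀ p ∈ B₁, ∀ j : ℕ, j ≤ J → p + (j : ℝ) • c ∈ P := by
    intro p hp j hj
    obtain ⟨⟨q, hq, hpq⟩, ha1, ha2, hlat⟩ := (hP₁mem p).1 (mem_filter.1 hp).1
    have hjR : (j : ℝ) ≤ J := by exact_mod_cast hj
    refine (hP _).2 ⟨?_, ?_, ?_, ?_⟩
    · -- lattice: `q + j•s ∈ Λ₀`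
      refine ⟨q + (j : ℝ) • s, hiter q hq j, ?_⟩
      show A (q + (j : ℝ) • s) + t = p + (j : ℝ) • c
      have hpq' : A q + t = p := hpq
      rw [map_add, LinearIsometryEquiv.map_smul, ← hpq', hc]; abel
    · have : (p + (j : ℝ) • c) 2 = p 2 + (j : ℝ) * c 2 := by rw [PiLp.add_apply, PiLp.smul_apply, smul_eq_mul]
      rw [this]; nlinarith [mul_nonneg (Nat.cast_nonneg j) hc2pos.le]
    · have : (p + (j : ℝ) • c) 2 = p 2 + (j : ℝ) * c 2 := by rw [PiLp.add_apply, PiLp.smul_apply, smul_eq_mul]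
      rw [this]; nlinarith [mul_le_mul_of_nonneg_right hjR hc2pos.le]
    · have h1 := hlat_iter p j
      have h2 : Real.sqrt (p 0 ^ 2 + p 1 ^ 2) ≤ ρ₁ := by
        rw [← Real.sqrt_sq hρ₁0]; exact Real.sqrt_le_sqrt hlat
      have h3 : Real.sqrt ((p + (j : ℝ) • c) 0 ^ 2 + (p + (j : ℝ) • c) 1 ^ 2) ≤ ρ := by
        have hj1 : (j : ℝ) ≤ Real.sqrt 2 * (R - 1) := hjR.trans hJR
        have hj2 : Real.sqrt 2 * (R - 1) ≤ 1.4143 * (R - 1) := mul_le_mul_of_nonneg_right hs2 (by linarith)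
        rw [hρ₁] at h2; linarith
      have h4 := pow_le_pow_left₀ (Real.sqrt_nonneg _) h3 2
      rwa [Real.sq_sqrt (by positivity)] at h4
  have hinj : ∀ p ∈ B₁, ∀ p' ∈ B₁, ∀ j j' : ℕ, p + (j : ℝ) • c = p' + (j' : ℝ) • c → p = p' ∧ j = j' := by
    intro p hp p' hp' j j' hjj
    have hpP₁ : p ∈ P₁ := (mem_filter.1 hp).1
    have hp'P₁ : p' ∈ P₁ := (mem_filter.1 hp').1
    obtain ⟨-, ha1, ha2, -⟩ := (hP₁mem p).1 hpP₁
    obtain ⟨-, ha1', ha2', -⟩ := (hP₁mem p').1 hp'P₁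
    have h2 := congrArg (fun v : E3 => v 2) hjj
    simp only [PiLp.add_apply, PiLp.smul_apply, smul_eq_mul] at h2
    -- `|j − j'|·c₂ ≤ 1 < 2 c₂`
    have hdiff : |((j : ℝ) - j')| * c 2 ≤ 1 := by
      rw [← abs_of_pos hc2pos, ← abs_mul, sub_mul]; rw [abs_le]; constructor <;> linarith
    have hlt2 : |((j : ℝ) - j')| < 2 := by
      by_contra hge; push Not at hge; nlinarith [hc2]
    have hcases : (j : ℤ) - j' = 0 ∨ (j : ℤ) - j' = 1 ∨ (j : ℤ) - j' = -1 := by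
      have : |((j : ℤ) - j' : ℤ)| < 2 := by
        have h' : (|((j : ℤ) - (j' : ℤ) : ℤ)| : ℝ) < 2 := by push_cast; exact hlt2
        exact_mod_cast h'
      rcases abs_lt.1 this with ⟨h1, h2⟩
      omega
    rcases hcases with h0 | h1 | h1
    · have hjj' : j = j' := by omega
      subst hjj'
      exact ⟨add_right_cancel hjj, rfl⟩
    · -- `j = j' + 1`: then `p' = p + c`, so `p' − c = p ∈ P₁`, contradicting `p' ∈ B₁`
      have hj : (j : ℝ) = j' + 1 := by
        have : (j : ℤ) = j' + 1 := by omega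
        exact_mod_cast this
      have key : p + c + (j' : ℝ) • c = p' + (j' : ℝ) • c := by
        rw [← hjj, hj, add_smul, one_smul]; abel
      have hp'c : p' - c = p := by rw [← add_right_cancel key]; abel
      exact absurd (hp'c ▸ hpP₁) (mem_filter.1 hp').2
    · have hj : (j' : ℝ) = j + 1 := by
        have : (j' : ℤ) = j + 1 := by omega
        exact_mod_cast this
      have key : p' + c + (j : ℝ) • c = p + (j : ℝ) • c := by
        rw [hjj, hj, add_smul, one_smul]; abel
      have hpc : p - c = p' := by rw [← add_right_cancel key]; abel
      exact absurd (hpc ▸ hp'P₁) (mem_filter.1 hp).2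
  -- count
  set S : Finset (E3 × ℕ) := B₁ ×ˢ Finset.range (J + 1) with hS
  have himg : (S.image fun x : E3 × ℕ => x.1 + (x.2 : ℝ) • c) ⊆ P := by
    intro y hy
    obtain ⟨x, hx, rfl⟩ := mem_image.1 hy
    obtain ⟨hx1, hx2⟩ := mem_product.1 hx
    exact hmapsP x.1 hx1 x.2 (Nat.lt_succ_iff.1 (mem_range.1 hx2))
  have hinjS : Set.InjOn (fun x : E3 × ℕ => x.1 + (x.2 : ℝ) • c) ↑S := by
    intro x hx x' hx' hxx
    obtain ⟨hx1, -⟩ := mem_product.1 (mem_coe.1 hx)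
    obtain ⟨hx1', -⟩ := mem_product.1 (mem_coe.1 hx')
    obtain ⟨h1, h2⟩ := hinj x.1 hx1 x'.1 hx1' x.2 x'.2 hxx
    exact Prod.ext h1 h2
  have hcount : B₁.card * (J + 1) ≤ P.card := by
    have h1 := card_le_card himg
    rw [card_image_of_injOn hinjS, hS, card_product, card_range] at h1
    exact h1
  have hcountR : (B₁.card : ℝ) * ((J : ℝ) + 1) ≤ P.card := by exact_mod_cast hcount
  -- arithmetic (kept linear: every product is named)
  have hπ := Real.pi_pos.le
  have hN0 : (0 : ℝ) ≤ (J : ℝ) + 1 := by positivity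
  have hJ1 : (R - 1) / c 2 ≤ (J : ℝ) + 1 := hJge.le
  have h2 : R - 1 ≤ c 2 * ((J : ℝ) + 1) := by
    have := mul_le_mul_of_nonneg_left hJ1 hc2pos.le
    rwa [mul_div_cancel₀ _ hc2pos.ne'] at this
  have h3 : (J : ℝ) + 1 ≤ Real.sqrt 2 * R := by linarith [hJR, hs2l]
  set X₁ : ℝ := Real.sqrt 2 * c 2 * Real.pi * ρ₁ ^ 2 - 10 * Real.sqrt 2 * Real.pi * ρ₁ with hX₁
  have hA0 : 0 ≤ Real.sqrt 2 * Real.pi * ρ₁ ^ 2 := by positivity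
  have hB0 : 0 ≤ 10 * Real.sqrt 2 * Real.pi * ρ₁ := by positivity
  -- `X₁ · (J+1) ≥ √2 π ρ₁² (R−1) − 20 π R ρ₁`
  have eX : X₁ * ((J : ℝ) + 1) =
      Real.sqrt 2 * Real.pi * ρ₁ ^ 2 * (c 2 * ((J : ℝ) + 1)) - 10 * Real.sqrt 2 * Real.pi * ρ₁ * ((J : ℝ) + 1) := by
    rw [hX₁]; ring
  have hT1 : Real.sqrt 2 * Real.pi * ρ₁ ^ 2 * (R - 1) ≤ Real.sqrt 2 * Real.pi * ρ₁ ^ 2 * (c 2 * ((J : ℝ) + 1)) :=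
    mul_le_mul_of_nonneg_left h2 hA0
  have hT2 : 10 * Real.sqrt 2 * Real.pi * ρ₁ * ((J : ℝ) + 1) ≤ 20 * Real.pi * R * ρ₁ := by
    have h := mul_le_mul_of_nonneg_left h3 hB0
    have e : 10 * Real.sqrt 2 * Real.pi * ρ₁ * (Real.sqrt 2 * R) = 10 * (Real.sqrt 2 * Real.sqrt 2) * Real.pi * R * ρ₁ := by ring
    rw [e, h22] at h
    linarith
  have hlow : Real.sqrt 2 * Real.pi * (R - 1) * (ρ - 2 * R) ^ 2 - 20 * Real.pi * R * (ρ - 2 * R) ≤ X₁ * ((J : ℝ) + 1) := by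
    rw [eX, ← hρ₁]; linarith
  by_cases hX : 0 ≤ X₁
  · -- positive bracket: multiply the two lower bounds
    have h1 : X₁ * ((J : ℝ) + 1) ≤ P.card :=
      le_trans (mul_le_mul_of_nonneg_right hB₁card hN0) hcountR
    linarith
  · -- negative bracket: `c₂ ρ₁ < 10`, so the claimed bound is negative
    push Not at hX
    have hρ₁pos : 0 < ρ₁ := by linarith
    have h1 : c 2 * ρ₁ < 10 := by
      by_contra hge
      push Not at hge
      have e : X₁ = Real.sqrt 2 * Real.pi * ρ₁ * (c 2 * ρ₁ - 10) := by rw [hX₁]; ring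
      have : 0 ≤ Real.sqrt 2 * Real.pi * ρ₁ * (c 2 * ρ₁ - 10) := mul_nonneg (by positivity) (by linarith)
      linarith
    have h4 : Real.sqrt 2 * ρ₁ < 20 := by
      have : Real.sqrt 2 / 2 * ρ₁ ≤ c 2 * ρ₁ := mul_le_mul_of_nonneg_right hc2 hρ₁pos.le
      linarith
    have h5 : Real.sqrt 2 * Real.pi * (R - 1) * ρ₁ ^ 2 ≤ 20 * Real.pi * R * ρ₁ := by
      have hC0 : 0 ≤ Real.pi * (R - 1) * ρ₁ := by
        have : 0 ≤ R - 1 := by linarith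
        positivity
      have h6 : Real.pi * (R - 1) * ρ₁ * (Real.sqrt 2 * ρ₁) ≤ Real.pi * (R - 1) * ρ₁ * 20 := mul_le_mul_of_nonneg_left h4.le hC0
      have e1 : Real.sqrt 2 * Real.pi * (R - 1) * ρ₁ ^ 2 = Real.pi * (R - 1) * ρ₁ * (Real.sqrt 2 * ρ₁) := by ring
      have h7 : Real.pi * (R - 1) * ρ₁ * 20 ≤ 20 * Real.pi * R * ρ₁ := by nlinarith [mul_nonneg hπ hρ₁pos.le]
      linarith
    have hP0 : (0 : ℝ) ≤ P.card := Nat.cast_nonneg _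
    linarith

/-- **Complete band ⇒ inner balls are trackable.**  If the band sample `P` (heights `[a, a+R]`, radius `ρ`) lies in `X`, then every point of the moved
lattice with height in `[a+1, a+R−1]` and lateral radius `≤ ρ − 1` has its whole `A`-dozen in `X` (`IsFull X A p`) and all its slot-predecessors in `X`. -/
theorem full_of_inner_band {X : Finset E3} (A : E3 ≃ₗᵢ[ℝ] E3) (t : E3) (a R ρ : ℝ) (P : Finset E3)
    (hP : ∀ p, p ∈ P ↔ (p ∈ (fun q => A q + t) '' fccStacking 1 (Real.sqrt (2 / 3)) ∧
      a ≤ p 2 ∧ p 2 ≤ a + R ∧ p 0 ^ 2 + p 1 ^ 2 ≤ ρ ^ 2))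
    (hPX : P ⊆ X) {p : E3} (hpΛ : p ∈ (fun q => A q + t) '' fccStacking 1 (Real.sqrt (2 / 3)))
    (h1 : a + 1 ≤ p 2) (h2 : p 2 ≤ a + R - 1) (hlat : Real.sqrt (p 0 ^ 2 + p 1 ^ 2) ≤ ρ - 1) :
    IsFull X A p ∧ ∀ w ∈ fccSlots, p - A w ∈ X := by
  obtain ⟨q, hq, hpq⟩ := hpΛ
  have hpq' : A q + t = p := hpq
  have key : ∀ w ∈ fccSlots, p + A w ∈ P := by
    intro w hw
    have hn : ‖A w‖ = 1 := by rw [LinearIsometryEquiv.norm_map, norm_eq_one_of_mem_fccSlots hw]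
    have h2abs : |(A w) 2| ≤ 1 := by
      have := Literature.Algebra.EuclideanLattices.norm_sq_fin_three (A w)
      rw [hn, one_pow] at this
      exact abs_le_one_iff_mul_self_le_one.2 (by nlinarith [sq_nonneg ((A w) 0), sq_nonneg ((A w) 1)])
    obtain ⟨hlo, hhi⟩ := abs_le.1 h2abs
    refine (hP _).2 ⟨⟨q + w, add_mem_fcc_of_mem_fccSlots hq hw, ?_⟩, ?_, ?_, ?_⟩
    · show A (q + w) + t = p + A w
      rw [map_add, ← hpq']; abel
    · rw [PiLp.add_apply]; linarith
    · rw [PiLp.add_apply]; linarith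
    · have hs := sqrt_lateral_add_le p (A w)
      rw [hn] at hs
      have h3 : Real.sqrt ((p + A w) 0 ^ 2 + (p + A w) 1 ^ 2) ≤ ρ := by linarith
      have h4 := pow_le_pow_left₀ (Real.sqrt_nonneg _) h3 2
      rwa [Real.sq_sqrt (by positivity)] at h4
  refine ⟨fun w hw => hPX (key w hw), fun w hw => ?_⟩
  have h := hPX (key (-w) (neg_mem_fccSlots hw))
  rwa [map_neg, ← sub_eq_add_neg] at h

end Summit.Ventures.Crystal3D.Theorems

end
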